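import Summits.HubbardSuperconductivity.HubbardSuperconductivity.Theorems.BalabanIRBirGappedPhaseReductionTorusZeroModeWeight
import HarnessLib

/-!
# Route BalabanIR — crux 4 `BirGappedPhaseReduction` / 4R (items `stmt-HubbardSuperconductivity-2082`, `…-14846`):
# the quasi-free Trotter weight does not see the Jordan–Wigner order — relabelling invariance, hence (P)

Hypothesis (P) of the restated engine (crux 2R, `BirComplexStableXYR`) asks the coupling table to be
even under spatial inversion; translation covariance is built into its `A θ = K Σ_s F(θ ∘ sh s)`. For
weights obtained by integrating out the fermions of a BdG reference these come for free from ONE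
structural fact, proved here on the many-body trace: for ANY bijection `σ : Λ' ≃ Λ` between finite
linearly ordered site sets (the orders — i.e. the Jordan–Wigner strings — need not correspond),

* `bdgNambuMatrix_relabel` — the Nambu matrix of the pulled-back bond data `τ ∘ (σ × σ)`, `Δ_t ∘ (σ × σ)`
  is the `σ`-relabelled Nambu matrix (orbital by orbital);
* **`trace_prod_gibbsWeight_bdgBondHamiltonian_relabel`** —
  `Tr_{𝓕(Λ')} ∏_t e^{-aH_BdG(τ_t ∘ σσ, Δ_t ∘ σσ, μ)} = Tr_{𝓕(Λ)} ∏_t e^{-aH_BdG(τ_t, Δ_t, μ)}`: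
  the Trotterised fermionic weight of a space-time pairing configuration is invariant under every
  relabelling of the sites, although the two Fock-space operators live on differently ordered
  Jordan–Wigner chains and are NOT unitarily related by a mere permutation of orbitals
  (proof: both sides are `e^{-aΣC_t}·det(1 + ∏_t e^{-a𝓗_t})` by the Trotter determinant formula
  `Literature/…/BdGBondHamiltonianTrotterDeterminant`, and the determinant is blind to `reindex`);
* `trace_prod_gibbsWeight_bdgBondHamiltonian_phase_relabel` — the instance for a phase field:
  data `τ(x,y)`, `Δ(x,y)·w(θ_t x, θ_t y)` and a symmetry `σ` of `τ`, `Δ` give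
  `W(θ ∘ σ) = W(θ)` (`W` = the Fock trace): with `σ` = inversion this is (P), with `σ` = a translation
  it is the site-independence of the induced table.

`Theses`-free, no definitions; `--supports` the crux. [folklore]
-/

noncomputable section

namespace Summit.HubbardSuperconductivity.HubbardSuperconductivity.Theorems

namespace BirBdG

open Matrix NormedSpace Literature.MathematicalPhysics.QuantumLattice

section Relabel

variable {Λ Λ' : Type*} [LinearOrder Λ] [Fintype Λ] [LinearOrder Λ'] [Fintype Λ']

/-- **Relabelling the sites relabels the Nambu matrix**, orbital by orbital:
`𝓗(τ∘σσ, Δ∘σσ, μ)_{(x,s),(y,s')} = 𝓗(τ, Δ, μ)_{(σx,s),(σy,s')}`. [folklore] -/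
theorem bdgNambuMatrix_relabel (σ : Λ' ≃ Λ) (τ Δ : Λ → Λ → ℂ) (μ : ℝ) :
    bdgNambuMatrix (fun u v => τ (σ u) (σ v)) (fun u v => Δ (σ u) (σ v)) μ =
      (bdgNambuMatrix τ Δ μ).submatrix (fun o : Orb Λ' => orb (σ (ofLex o).1) (ofLex o).2)
        (fun o : Orb Λ' => orb (σ (ofLex o).1) (ofLex o).2) := by
  ext o o'
  obtain ⟨⟨x, s⟩, rfl⟩ : ∃ p : Λ' × Fin 2, toLex p = o := ⟨ofLex o, rfl⟩
  obtain ⟨⟨y, s'⟩, rfl⟩ : ∃ p : Λ' × Fin 2, toLex p = o' := ⟨ofLex o', rfl⟩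
  simp only [submatrix_apply, ofLex_toLex]
  change bdgNambuMatrix _ _ μ (orb x s) (orb y s') = bdgNambuMatrix τ Δ μ (orb (σ x) s) (orb (σ y) s')
  rw [bdgNambuMatrix_orb_orb, bdgNambuMatrix_orb_orb]
  simp only [EmbeddingLike.apply_eq_iff_eq]

/-- **The Trotterised quasi-free weight is blind to the Jordan–Wigner order (relabelling
invariance).** For any bijection `σ : Λ' ≃ Λ` of finite linearly ordered site sets and slice data
`τ_t, Δ_t`, `μ`, `a`:
`Tr_{𝓕(Λ')} ∏_t e^{-aH_BdG(τ_t∘σσ, Δ_t∘σσ, μ)} = Tr_{𝓕(Λ)} ∏_t e^{-aH_BdG(τ_t, Δ_t, μ)}`. [folklore] -/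
theorem trace_prod_gibbsWeight_bdgBondHamiltonian_relabel (σ : Λ' ≃ Λ) {M : ℕ}
    (τ Δ : Fin M → Λ → Λ → ℂ) (μ a : ℝ) :
    ((List.ofFn fun t => Matrix.gibbsWeight a
        (bdgBondHamiltonian (fun u v => τ t (σ u) (σ v)) (fun u v => Δ t (σ u) (σ v)) μ)).prod).trace =
      ((List.ofFn fun t => Matrix.gibbsWeight a (bdgBondHamiltonian (τ t) (Δ t) μ)).prod).trace := by
  rw [trace_prod_gibbsWeight_bdgBondHamiltonian (fun t u v => τ t (σ u) (σ v))
      (fun t u v => Δ t (σ u) (σ v)) μ a,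
    trace_prod_gibbsWeight_bdgBondHamiltonian τ Δ μ a]
  congr 1
  · congr 2
    refine Finset.sum_congr rfl fun t _ => ?_
    exact σ.sum_comp (fun x => τ t x x - (μ : ℂ))
  · -- the orbital relabelling as an equivalence `Orb Λ ≃ Orb Λ'`
    let E : Orb Λ ≃ Orb Λ' :=
      { toFun := fun o => orb (σ.symm (ofLex o).1) (ofLex o).2
        invFun := fun o => orb (σ (ofLex o).1) (ofLex o).2
        left_inv := fun o => by
          simp only [ofLex_toLex, Equiv.apply_symm_apply]
          rfl
        right_inv := fun o => by
          simp only [ofLex_toLex, Equiv.symm_apply_apply]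
          rfl }
    have hE : ∀ t, bdgNambuMatrix (fun u v => τ t (σ u) (σ v)) (fun u v => Δ t (σ u) (σ v)) μ =
        reindex E E (bdgNambuMatrix (τ t) (Δ t) μ) := fun t => by
      rw [bdgNambuMatrix_relabel]
      rfl
    simp_rw [hE, gibbsWeight_reindex_self]
    rw [show (List.ofFn fun t => reindex E E (Matrix.gibbsWeight a (bdgNambuMatrix (τ t) (Δ t) μ))) =
        (List.ofFn fun t => Matrix.gibbsWeight a (bdgNambuMatrix (τ t) (Δ t) μ)).map fun X => reindex E E X by
      rw [List.map_ofFn]; rfl]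
    have h := det_one_add_prod_map_reindex E
      (List.ofFn fun t => Matrix.gibbsWeight a (bdgNambuMatrix (τ t) (Δ t) μ)) (fun X => X)
    rwa [List.map_id'] at h

/-- **(P) and site-independence for free.** For bond data `τ`, `Δ` invariant under a site
bijection `σ : Λ ≃ Λ` (e.g. spatial inversion, or a translation of a torus), any two-point phase
dressing `w`, and any space-time phase field `θ_t`, the Trotterised fermionic weight satisfies
`W(θ ∘ σ) = W(θ)`. [folklore] -/
theorem trace_prod_gibbsWeight_bdgBondHamiltonian_phase_relabel (σ : Λ ≃ Λ) (τ Δ : Λ → Λ → ℂ)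
    (hτ : ∀ u v, τ (σ u) (σ v) = τ u v) (hΔ : ∀ u v, Δ (σ u) (σ v) = Δ u v) (w : ℝ → ℝ → ℂ)
    (μ a : ℝ) {M : ℕ} (θ : Fin M → Λ → ℝ) :
    ((List.ofFn fun t => Matrix.gibbsWeight a
        (bdgBondHamiltonian τ (fun u v => Δ u v * w (θ t (σ u)) (θ t (σ v))) μ)).prod).trace =
      ((List.ofFn fun t => Matrix.gibbsWeight a
        (bdgBondHamiltonian τ (fun u v => Δ u v * w (θ t u) (θ t v)) μ)).prod).trace := by
  have h := trace_prod_gibbsWeight_bdgBondHamiltonian_relabel σ (fun _ => τ)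
    (fun t u v => Δ u v * w (θ t u) (θ t v)) μ a
  simp only [hτ, hΔ] at h
  exact h

end Relabel

end BirBdG

end Summit.HubbardSuperconductivity.HubbardSuperconductivity.Theorems
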